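import Literature.Analysis.InverseSpectral.HelicalFunctionProofsCompact
import HarnessLib

/-!
# Kreĭn's representation theorem for helical functions: the discharge

Last file of the proof of the named fact
`Literature.Analysis.InverseSpectral.KreinHelicalRepresentation` (Arov–Dym 2012, Thm 9.1, scalar
case `p = 1`), `theorem KreinHelicalRepresentation_holds`.

The hard direction feeds `krein_rep_of_lattice_data` (sibling file `HelicalFunctionProofsCompact`)
with lattice data:

* the **second-difference form**: for a helical `g` the sesquilinear form
  `∑ conj cᵢ cⱼ d(qᵢ - qⱼ)`, `d(k) = 2g(kh) - g((k+1)h) - g((k-1)h)`, is the kernel form of `g` on the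
  doubled configuration `{qᵢ h, (qᵢ+1) h}` with coefficients `∓cᵢ`, hence nonnegative
  (`second_diff_form_eq`);
* on `[-a, a]` (`IsHelicalOn`) this makes the Toeplitz section `(d(i - j))_{i,j < 2^{n+3}}` positive
  semidefinite, and the **Carathéodory–Toeplitz theorem** (`caratheodory_toeplitz`) extends it to a
  positive-definite sequence on `ℤ` (`exists_data_Icc`); on `ℝ` (`IsHelical`) the sequence `d`
  itself is positive definite (`exists_data_univ`);
* the dyadic points `j a/2^m` are dense in `[-a, a]` and in `ℝ`.

The easy direction is `IsKreinHelicalMeasure.isHelicalOn_of_eqOn` /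
`IsKreinHelicalMeasure.isHelical_kreinHelicalRep` (`HelicalFunctionProofsConverse`).

## References

* D. Z. Arov, H. Dym, *Bitangential direct and inverse problems for systems of integral and
  differential equations*, CUP 2012, §9.1, Theorem 9.1.
* M. G. Kreĭn, *On the problem of continuation of helical arcs in Hilbert space*, Dokl. Akad.
  Nauk SSSR 45 (1944) 139–142.
-/

open MeasureTheory Set Complex Filter Finset Literature.Analysis.FunctionSpaces
open scoped ComplexConjugate ENNReal NNReal Topology BigOperators ComplexOrder

noncomputable section

namespace Literature.Analysis.InverseSpectral

/-! ### The second-difference form is a kernel form -/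

/-- Kernel positivity transfers from `Fin n`-indexed to arbitrarily indexed finite configurations.
[folklore] -/
lemma sum_kernel_nonneg_of_fin {g : ℝ → ℂ} {P : Set ℝ}
    (hker : ∀ (n : ℕ) (t : Fin n → ℝ) (ξ : Fin n → ℂ), (∀ i, t i ∈ P) →
      0 ≤ ∑ i, ∑ j, conj (ξ i) * helicalKernel g (t i) (t j) * ξ j)
    {ι : Type*} [Fintype ι] (t : ι → ℝ) (ξ : ι → ℂ) (ht : ∀ i, t i ∈ P) :
    0 ≤ ∑ i, ∑ j, conj (ξ i) * helicalKernel g (t i) (t j) * ξ j := by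
  set e := Fintype.equivFin ι with he
  have h := hker _ (fun i => t (e.symm i)) (fun i => ξ (e.symm i)) (fun i => ht _)
  have h1 : ∑ i, ∑ j, conj (ξ (e.symm i)) * helicalKernel g (t (e.symm i)) (t (e.symm j)) *
      ξ (e.symm j) = ∑ i, ∑ j, conj (ξ i) * helicalKernel g (t i) (t j) * ξ j := by
    rw [Equiv.sum_comp e.symm (fun i => ∑ j, conj (ξ i) * helicalKernel g (t i) (t (e.symm j)) *
      ξ (e.symm j))]
    exact Finset.sum_congr rfl fun i _ =>
      Equiv.sum_comp e.symm (fun j => conj (ξ i) * helicalKernel g (t i) (t j) * ξ j)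
  rwa [h1] at h

/-- **The second-difference form is a kernel form.** With `d(k) = 2g(kh) - g((k+1)h) - g((k-1)h)`:
`∑ᵢⱼ conj cᵢ d(qᵢ - qⱼ) cⱼ` equals the kernel form `∑ conj ξ_p k_g(t_p, t_{p'}) ξ_{p'}` of the
doubled configuration `t_{(i,b)} = (qᵢ + [b]) h`, `ξ_{(i,b)} = ± cᵢ`. [folklore] -/
lemma second_diff_form_eq (g : ℝ → ℂ) (h : ℝ) {ι : Type*} [Fintype ι] (q : ι → ℤ) (c : ι → ℂ) :
    ∑ i, ∑ j, conj (c i) * (2 * g ((q i - q j : ℤ) * h) - g (((q i - q j : ℤ) + 1) * h) -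
        g (((q i - q j : ℤ) - 1) * h)) * c j =
      ∑ p : ι ⊕ ι, ∑ p' : ι ⊕ ι,
        conj (Sum.elim c (fun i => -c i) p) *
          helicalKernel g (Sum.elim (fun i => ((q i : ℝ) + 1) * h) (fun i => (q i : ℝ) * h) p)
            (Sum.elim (fun i => ((q i : ℝ) + 1) * h) (fun i => (q i : ℝ) * h) p') *
          Sum.elim c (fun i => -c i) p' := by
  simp only [Fintype.sum_sum_type, Sum.elim_inl, Sum.elim_inr, helicalKernel]
  rw [← Finset.sum_add_distrib]
  refine Finset.sum_congr rfl fun i _ => ?_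
  rw [← Finset.sum_add_distrib, ← Finset.sum_add_distrib, ← Finset.sum_add_distrib]
  refine Finset.sum_congr rfl fun j _ => ?_
  push_cast
  simp only [map_neg]
  ring_nf

/-- The second-difference form of a kernel-positive `g` is nonnegative when the doubled
configuration lies in the positivity set. [folklore] -/
lemma second_diff_form_nonneg {g : ℝ → ℂ} {P : Set ℝ}
    (hker : ∀ (n : ℕ) (t : Fin n → ℝ) (ξ : Fin n → ℂ), (∀ i, t i ∈ P) →
      0 ≤ ∑ i, ∑ j, conj (ξ i) * helicalKernel g (t i) (t j) * ξ j)
    (h : ℝ) {ι : Type*} [Fintype ι] (q : ι → ℤ) (c : ι → ℂ)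
    (hq : ∀ i, ((q i : ℝ)) * h ∈ P ∧ ((q i : ℝ) + 1) * h ∈ P) :
    0 ≤ ∑ i, ∑ j, conj (c i) * (2 * g ((q i - q j : ℤ) * h) - g (((q i - q j : ℤ) + 1) * h) -
        g (((q i - q j : ℤ) - 1) * h)) * c j := by
  rw [second_diff_form_eq]
  refine sum_kernel_nonneg_of_fin hker _ _ fun p => ?_
  rcases p with i | i
  · simpa using (hq i).2
  · simpa using (hq i).1

/-! ### Lattice data: the interval case (Carathéodory–Toeplitz) and the line case -/

/-- **Lattice data on `[-a, a]`.** For `g` helical on `[-a, a]` and the mesh `h = a/2^{n+3}` the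
Toeplitz section `(d(i - j))_{i,j < 2^{n+3}}` of second differences is positive semidefinite, so by
the Carathéodory–Toeplitz theorem there is a positive-definite `D` on `ℤ` with `D(j) = d(j)`
whenever `(|j| + 1) h ≤ a`. [folklore] -/
theorem exists_data_Icc {a : ℝ} (ha : 0 < a) {g : ℝ → ℂ} (hg : IsHelicalOn a g) (n : ℕ) :
    ∃ D : ℤ → ℂ, IsPositiveDefinite D ∧
      ∀ j : ℤ, (|(j : ℝ)| + 1) * (a / 2 ^ (n + 3)) ∈ Set.Icc (-a) a →
        D j = 2 * g (j * (a / 2 ^ (n + 3))) - g ((j + 1) * (a / 2 ^ (n + 3))) -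
          g ((j - 1) * (a / 2 ^ (n + 3))) := by
  set h : ℝ := a / 2 ^ (n + 3) with hhdef
  have hpos : 0 < h := by positivity
  set m : ℕ := 2 ^ (n + 3) - 1 with hm
  have hm1 : m + 1 = 2 ^ (n + 3) := Nat.sub_add_cancel Nat.one_le_two_pow
  have hmh : ((m : ℝ) + 1) * h = a := by
    have : ((m : ℝ) + 1) = ((m + 1 : ℕ) : ℝ) := by push_cast; ring
    rw [this, hm1, hhdef]; push_cast; field_simp
  -- the second differences
  set d : ℤ → ℂ := fun k => 2 * g (k * h) - g ((k + 1) * h) - g ((k - 1) * h) with hd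
  -- membership in `[-a, a]`
  have hmem : ∀ s : ℝ, |s| ≤ ((m : ℝ) + 1) * h → s ∈ Set.Icc (-a) a := fun s hs => by
    rw [hmh] at hs; exact abs_le.1 hs
  -- Hermitian symmetry of `d` on the valid range
  have hdsymm : ∀ k : ℤ, |k| ≤ m → conj (d k) = d (-k) := by
    intro k hk
    have hk' : |(k : ℝ)| ≤ m := by exact_mod_cast hk
    have h1 : (k : ℝ) * h ∈ Set.Icc (-a) a := hmem _ (by
      rw [abs_mul, abs_of_pos hpos]; nlinarith [abs_nonneg (k : ℝ)])
    have h2 : ((k : ℝ) + 1) * h ∈ Set.Icc (-a) a := hmem _ (by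
      rw [abs_mul, abs_of_pos hpos]
      have := abs_add_le (k : ℝ) 1
      rw [abs_one] at this
      nlinarith)
    have h3 : ((k : ℝ) - 1) * h ∈ Set.Icc (-a) a := hmem _ (by
      rw [abs_mul, abs_of_pos hpos]
      have := abs_sub (k : ℝ) 1
      rw [abs_one] at this
      nlinarith)
    simp only [hd, map_sub, map_mul]
    rw [← hg.2.1 _ h1, ← hg.2.1 _ h2, ← hg.2.1 _ h3]
    push_cast
    rw [map_ofNat]
    ring_nf
  -- the Toeplitz section is positive semidefinite
  have hPSD : (Matrix.of fun i j : Fin (m + 1) => d (-((j : ℤ) - i))).PosSemidef := by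
    refine Matrix.PosSemidef.of_dotProduct_mulVec_nonneg ?_ fun x => ?_
    · refine Matrix.IsHermitian.ext fun i j => ?_
      simp only [Matrix.of_apply, RCLike.star_def]
      rw [hdsymm _ (by
        rw [neg_sub, abs_le]
        constructor <;> linarith [(Nat.cast_nonneg (α := ℤ) i), (Nat.cast_nonneg (α := ℤ) j),
          (show ((i : ℕ) : ℤ) ≤ m by exact_mod_cast Nat.le_of_lt_succ i.2),
          (show ((j : ℕ) : ℤ) ≤ m by exact_mod_cast Nat.le_of_lt_succ j.2)])]
      congr 1
      ring
    · -- `xᴴ M x` is the second-difference form with `qᵢ = i`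
      have hform : dotProduct (star x)
          (Matrix.mulVec (Matrix.of fun i j : Fin (m + 1) => d (-((j : ℤ) - i))) x) =
          ∑ i : Fin (m + 1), ∑ j : Fin (m + 1), conj (x i) *
            (2 * g ((((i : ℕ) : ℤ) - ((j : ℕ) : ℤ) : ℤ) * h) -
              g (((((i : ℕ) : ℤ) - ((j : ℕ) : ℤ) : ℤ) + 1) * h) -
              g (((((i : ℕ) : ℤ) - ((j : ℕ) : ℤ) : ℤ) - 1) * h)) * x j := by
        simp only [dotProduct, Matrix.mulVec, Matrix.of_apply, Pi.star_apply, RCLike.star_def,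
          Finset.mul_sum, hd]
        refine Finset.sum_congr rfl fun i _ => Finset.sum_congr rfl fun j _ => ?_
        push_cast
        ring_nf
      rw [hform]
      refine second_diff_form_nonneg (P := Set.Icc 0 a) hg.2.2 h (fun i : Fin (m + 1) => ((i : ℕ) : ℤ))
        x fun i => ⟨⟨?_, ?_⟩, ?_, ?_⟩
      · exact mul_nonneg (by positivity) hpos.le
      · rw [← hmh]
        have : (((i : ℕ) : ℤ) : ℝ) ≤ m := by exact_mod_cast Nat.le_of_lt_succ i.2
        push_cast at this ⊢
        nlinarith
      · exact mul_nonneg (by positivity) hpos.le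
      · rw [← hmh]
        have : (((i : ℕ) : ℤ) : ℝ) ≤ m := by exact_mod_cast Nat.le_of_lt_succ i.2
        push_cast at this ⊢
        nlinarith
  -- Carathéodory–Toeplitz, then reflect
  obtain ⟨Dc, hDc, hDcEq⟩ := caratheodory_toeplitz (fun k => d (-k)) hPSD
  refine ⟨fun k => Dc (-k), isPositiveDefinite_comp_neg hDc, fun j hj => ?_⟩
  have hjm : |j| ≤ m := by
    have h1 : (|(j : ℝ)| + 1) * h ≤ ((m : ℝ) + 1) * h := by rw [hmh]; exact hj.2
    have h2 := le_of_mul_le_mul_right h1 hpos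
    have h3 : |(j : ℝ)| ≤ m := by linarith
    exact_mod_cast h3
  dsimp only
  rw [hDcEq (-j) (by rwa [abs_neg]), neg_neg]

/-- **Lattice data on `ℝ`.** For `g` helical on `ℝ` the second differences
`d(k) = 2g(kh) - g((k+1)h) - g((k-1)h)` form a positive-definite sequence on `ℤ`. [folklore] -/
theorem exists_data_univ {g : ℝ → ℂ} (hg : IsHelical g) (h : ℝ) (hh : 0 < h) :
    ∃ D : ℤ → ℂ, IsPositiveDefinite D ∧
      ∀ j : ℤ, D j = 2 * g (j * h) - g ((j + 1) * h) - g ((j - 1) * h) := by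
  set d : ℤ → ℂ := fun k => 2 * g (k * h) - g ((k + 1) * h) - g ((k - 1) * h) with hd
  -- `k ↦ d(-k)` is positive definite: shift configurations into `ℕ` and use the kernel form
  have hneg : IsPositiveDefinite fun k => d (-k) := by
    intro n x c
    set N : ℕ := ∑ i, (x i).natAbs with hN
    have hxN : ∀ i, 0 ≤ x i + N := by
      intro i
      have h1 : |x i| ≤ N := by
        rw [hN]; push_cast
        exact Finset.single_le_sum (f := fun j => |x j|) (fun j _ => abs_nonneg _) (Finset.mem_univ i)
      have h2 : -x i ≤ |x i| := neg_le_abs _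
      linarith
    have hform : (∑ i, ∑ j, conj (c i) * c j * (fun k => d (-k)) (x j - x i)) =
        ∑ i, ∑ j, conj (c i) * (2 * g (((x i + N) - (x j + N) : ℤ) * h) -
          g ((((x i + N) - (x j + N) : ℤ) + 1) * h) - g ((((x i + N) - (x j + N) : ℤ) - 1) * h)) * c j := by
      refine Finset.sum_congr rfl fun i _ => Finset.sum_congr rfl fun j _ => ?_
      simp only [hd, neg_sub, add_sub_add_right_eq_sub]
      ring
    rw [hform]
    have hnn := second_diff_form_nonneg (P := Set.Ici 0) (fun n t ξ ht => hg.2.2 n t ξ ht) h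
      (fun i => x i + N) c (fun i => ⟨?_, ?_⟩)
    · exact ⟨by simpa using (Complex.le_def.1 hnn).1, by simpa using (Complex.le_def.1 hnn).2.symm⟩
    · exact mul_nonneg (by exact_mod_cast hxN i) hh.le
    · refine mul_nonneg ?_ hh.le
      have h0 : (0 : ℝ) ≤ ((x i + N : ℤ) : ℝ) := by exact_mod_cast hxN i
      push_cast at h0 ⊢
      linarith
  refine ⟨d, ?_, fun j => rfl⟩
  have := isPositiveDefinite_comp_neg hneg
  simpa using this

/-! ### Density of dyadic points -/

/-- The dyadic multiples `j a/2^m` of `a > 0` lying in `[-a, a]` are dense in `[-a, a]`.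
[folklore] -/
lemma Icc_subset_closure_dyadic {a : ℝ} (ha : 0 < a) :
    Set.Icc (-a) a ⊆ closure {t ∈ Set.Icc (-a) a | ∃ m : ℕ, ∃ j : ℤ, t = j * (a / 2 ^ m)} := by
  intro t ht
  -- `s m = ⌊t 2^m / a⌋ a / 2^m`
  set s : ℕ → ℝ := fun m => (⌊t * 2 ^ m / a⌋ : ℝ) * (a / 2 ^ m) with hs
  have hle : ∀ m, s m ≤ t := fun m => by
    simp only [hs]
    have := Int.floor_le (t * 2 ^ m / a)
    calc (⌊t * 2 ^ m / a⌋ : ℝ) * (a / 2 ^ m) ≤ (t * 2 ^ m / a) * (a / 2 ^ m) := by gcongr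
      _ = t := by field_simp
  have hge : ∀ m, t - a / 2 ^ m ≤ s m := fun m => by
    simp only [hs]
    have := Int.lt_floor_add_one (t * 2 ^ m / a)
    have h1 : (t * 2 ^ m / a - 1) * (a / 2 ^ m) ≤ (⌊t * 2 ^ m / a⌋ : ℝ) * (a / 2 ^ m) := by
      gcongr; linarith
    calc t - a / 2 ^ m = (t * 2 ^ m / a - 1) * (a / 2 ^ m) := by field_simp
      _ ≤ _ := h1
  have hmem : ∀ m, s m ∈ Set.Icc (-a) a := fun m => by
    refine ⟨?_, (hle m).trans ht.2⟩
    simp only [hs]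
    have h1 : (-(2 ^ m : ℤ) : ℤ) ≤ ⌊t * 2 ^ m / a⌋ := by
      rw [Int.le_floor]
      push_cast
      rw [le_div_iff₀ ha]
      nlinarith [ht.1, pow_pos (by norm_num : (0 : ℝ) < 2) m]
    have h2 : (-(2 ^ m : ℝ)) ≤ (⌊t * 2 ^ m / a⌋ : ℝ) := by exact_mod_cast h1
    calc -a = (-(2 ^ m : ℝ)) * (a / 2 ^ m) := by field_simp
      _ ≤ _ := by gcongr
  have htend : Tendsto s atTop (𝓝 t) := by
    have h0 : Tendsto (fun m : ℕ => t - a / 2 ^ m) atTop (𝓝 (t - a * 0)) := by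
      have : Tendsto (fun m : ℕ => a * (2 ^ m : ℝ)⁻¹) atTop (𝓝 (a * 0)) :=
        (tendsto_inv_atTop_zero.comp (tendsto_pow_atTop_atTop_of_one_lt one_lt_two)).const_mul a
      exact (tendsto_const_nhds.sub this).congr fun m => by simp [div_eq_mul_inv]
    rw [mul_zero, sub_zero] at h0
    exact tendsto_of_tendsto_of_tendsto_of_le_of_le h0 tendsto_const_nhds hge hle
  exact mem_closure_of_tendsto htend (Eventually.of_forall fun m => ⟨hmem m, m, _, rfl⟩)

/-- The dyadic multiples `j a/2^m` of `a > 0` are dense in `ℝ`. [folklore] -/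
lemma univ_subset_closure_dyadic {a : ℝ} (ha : 0 < a) :
    (Set.univ : Set ℝ) ⊆ closure {t ∈ (Set.univ : Set ℝ) | ∃ m : ℕ, ∃ j : ℤ, t = j * (a / 2 ^ m)} := by
  intro t _
  set s : ℕ → ℝ := fun m => (⌊t * 2 ^ m / a⌋ : ℝ) * (a / 2 ^ m) with hs
  have hle : ∀ m, s m ≤ t := fun m => by
    simp only [hs]
    have := Int.floor_le (t * 2 ^ m / a)
    calc (⌊t * 2 ^ m / a⌋ : ℝ) * (a / 2 ^ m) ≤ (t * 2 ^ m / a) * (a / 2 ^ m) := by gcongr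
      _ = t := by field_simp
  have hge : ∀ m, t - a / 2 ^ m ≤ s m := fun m => by
    simp only [hs]
    have := Int.lt_floor_add_one (t * 2 ^ m / a)
    have h1 : (t * 2 ^ m / a - 1) * (a / 2 ^ m) ≤ (⌊t * 2 ^ m / a⌋ : ℝ) * (a / 2 ^ m) := by
      gcongr; linarith
    calc t - a / 2 ^ m = (t * 2 ^ m / a - 1) * (a / 2 ^ m) := by field_simp
      _ ≤ _ := h1
  have htend : Tendsto s atTop (𝓝 t) := by
    have h0 : Tendsto (fun m : ℕ => t - a / 2 ^ m) atTop (𝓝 (t - a * 0)) := by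
      have : Tendsto (fun m : ℕ => a * (2 ^ m : ℝ)⁻¹) atTop (𝓝 (a * 0)) :=
        (tendsto_inv_atTop_zero.comp (tendsto_pow_atTop_atTop_of_one_lt one_lt_two)).const_mul a
      exact (tendsto_const_nhds.sub this).congr fun m => by simp [div_eq_mul_inv]
    rw [mul_zero, sub_zero] at h0
    exact tendsto_of_tendsto_of_tendsto_of_le_of_le h0 tendsto_const_nhds hge hle
  exact mem_closure_of_tendsto htend (Eventually.of_forall fun m => ⟨Set.mem_univ _, m, _, rfl⟩)

/-! ### The discharge -/

/-- **Kreĭn's representation theorem for helical functions** (Arov–Dym 2012, Thm 9.1, scalar case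
`p = 1`; M. G. Kreĭn 1944): discharge of the named fact
`Literature.Analysis.InverseSpectral.KreinHelicalRepresentation`.

(i) For `0 < a < ∞`, `g` is helical on `[-a, a]` iff
`g(t) = -β + itα + (1/π) ∫ (e^{-iμt} - 1 + iμt/(1+μ²)) dσ(μ)/μ²` on `[-a, a]` for some `α, β ∈ ℝ` and
a measure `σ` with `∫ dσ/(1+μ²) < ∞`; (ii) the same on `ℝ`. The easy directions are dominated
convergence (`HelicalFunctionProofsConverse`). The hard directions are proved by discretisation:
the second differences of the samples `g(jh)` on the dyadic meshes `h = a/2^{n+3}` form positive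
semidefinite Toeplitz sections, which the Carathéodory–Toeplitz theorem extends to positive-definite
sequences on `ℤ` (`HelicalFunctionProofsToeplitz`); their Fejér measures, rescaled, represent `g`
on the lattice up to `o(1)` with uniformly bounded, uniformly tight measures
(`HelicalFunctionProofsLattice`, `HelicalFunctionProofsLimit`); Prokhorov's theorem and continuity
give Kreĭn's formula (`HelicalFunctionProofsCompact`). [cite: ArovDym2012, Thm 9.1] -/
theorem KreinHelicalRepresentation_holds : KreinHelicalRepresentation := by
  refine ⟨fun a ha g => ⟨fun hg => ?_, ?_⟩, fun g => ⟨fun hg => ?_, ?_⟩⟩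
  · -- (i), `⟹`: interval case
    choose D hD hDd using exists_data_Icc ha hg
    exact krein_rep_of_lattice_data (S := Set.Icc (-a) a) ha subset_rfl
      (fun t ht s hs => abs_le.1 (hs.trans (abs_le.2 ⟨ht.1, ht.2⟩)))
      (Icc_subset_closure_dyadic ha) hg.1 hg.2.1 hD hDd
  · -- (i), `⟸`
    rintro ⟨α, β, σ, hσ, hrep⟩
    exact hσ.isHelicalOn_of_eqOn hrep
  · -- (ii), `⟹`: the line, with `a = 1`
    choose D hD hDd using fun n : ℕ => exists_data_univ hg (1 / 2 ^ (n + 3)) (by positivity)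
    obtain ⟨α, β, σ, hσ, hrep⟩ := krein_rep_of_lattice_data (S := Set.univ) (a := 1) one_pos
      (Set.subset_univ _) (fun _ _ _ _ => Set.mem_univ _) (univ_subset_closure_dyadic one_pos)
      hg.1.continuousOn (fun t _ => hg.2.1 t) hD (fun n j _ => hDd n j)
    exact ⟨α, β, σ, hσ, fun t => hrep t (Set.mem_univ t)⟩
  · -- (ii), `⟸`
    rintro ⟨α, β, σ, hσ, hrep⟩
    have : g = kreinHelicalRep α β σ := funext hrep
    rw [this]
    exact hσ.isHelical_kreinHelicalRep α β

end Literature.Analysis.InverseSpectral
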